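import Summits.Ventures.LatticeQCDFlow.Exactness.PTBCSwapMonitor
import Summits.Ventures.LatticeQCDFlow.Exactness.Phi4HMCFluctuationRelation
import Summits.Ventures.LatticeQCDFlow.Scaling.GaussianWeights
import Summits.Ventures.LatticeQCDFlow.Scaling.SwapSpacingOptimum
import Summits.Ventures.LatticeQCDFlow.Scaling.SwapSpacingBrackets

/-!
HONEST FRAMING: exact (Metropolis-corrected) sampling algorithms for lattice gauge theory; figures
of merit are autocorrelation/cost numbers at stated couplings and volumes; no continuum-physics
claim.

# PTBCSwapSignRule — THE SIGN RULE OF THE REPLICA-EXCHANGE SWAP: IN EQUILIBRIUM THE MEAN SWAP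
# ACCEPTANCE EQUALS `P(ΔS ≤ 0) + P(ΔS < 0)` EXACTLY (A BOUNDED EXACTNESS TRIPWIRE), WHEREAS THE CARD'S
# `⟨e^{−ΔS}⟩ = 1` MONITOR HAS MODEL VARIANCE `e^{Var ΔS} − 1 > 600` AT SWAP ACCEPTANCES `≤ 20 %`
# (row 22 `su3-ptbc`, GEN-5, ours; sequel of `PTBCSwapMonitor`)

Venture `LatticeQCDFlow` (cell pub-lqcd), topic `Exactness`; FANOUT row 22 (`su3-ptbc`, PTBC comparator arm
E4).  NEW WORK of the cell = an INSTANCE of row 2's fluctuation relation for measure-preserving involutive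
proposals (`Exactness/Phi4HMCFluctuationRelation`: `integral_comp_deltaH_eq`, `acceptance_integral_eq`,
`negative_tail_integral_le`) for the PTBC swap proposal `z ↦ z.swap` of `Exactness/PTBCSwapMonitor`
(`pairEnergy`, `swapDelta`, `measurePreserving_swap_prod_self`), plus the Gaussian log-weight law of
`Scaling/GaussianWeights` (`Theory2.gaussian_logweight_law`) and the certified bracket `erfc 0.9 > 1/5`
of `Scaling/SwapSpacingBrackets`.  Nothing is cited as a fact.

## What is proved

§1 (two replica slots with measurable actions `S₁, S₂ : Ω → ℝ` over an s-finite reference measure `vol`;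
joint weight `e^{−E}`, `E = pairEnergy S₁ S₂`, on `vol ⊗ vol`; swap energy `ΔS = swapDelta S₁ S₂`
`= E∘swap − E` (`deltaH_pairEnergy_swap`))
* **`swap_fluctuation_relation`** — for EVERY `g : ℝ → ℝ`:
  `∫ g(ΔS) e^{−E} = ∫ g(−ΔS) e^{−ΔS} e^{−E}` (GEN-2's `⟨e^{−ΔS}⟩ = 1` is `g = 1`);
* **`swap_acceptance_sign_rule`** (`e^{−E}` integrable) —
  `∫ min(1, e^{−ΔS}) e^{−E} = ∫ 𝟙[ΔS ≤ 0] e^{−E} + ∫ 𝟙[ΔS < 0] e^{−E}`: THE STATIONARY MEAN SWAP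
  ACCEPTANCE IS `P(ΔS ≤ 0) + P(ΔS < 0)` (`= 2P(ΔS < 0) + P(ΔS = 0)`); normalised form
  **`swap_acceptance_sign_rule_boltzmann`** under the joint Boltzmann law
  `HMC.boltzmann (vol ⊗ vol) E` (`Z > 0`);
* `swap_negative_tail_le` — `∫ 𝟙[ΔS ≤ −c] e^{−E} ≤ e^{−c} ∫ 𝟙[ΔS ≥ c] e^{−E}`: downhill swap energies
  beyond `c` are exponentially rare in equilibrium;
* `signRuleStat`, **`signRuleStat_sq_le_one`**, `swap_signRuleStat_integral_eq_zero` (+ `_boltzmann_`) — the per-proposal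
  statistic `T = min(1, e^{−ΔS}) − 𝟙[ΔS ≤ 0] − 𝟙[ΔS < 0]` takes values in `[−1, 1]` and has
  equilibrium mean `0`: a tripwire whose single-proposal variance is `≤ 1` WHATEVER the actions, the
  defect, the couplings.
§2 (the Gaussian swap model (M1) of `Scaling/SwapSpacingOptimum`: `ΔS ∼ N(m, v)` under the stationary pair
law; the exact `⟨e^{−ΔS}⟩ = 1` forces `m = v/2` and the model acceptance is `erfc(√v/(2√2))`)
* **`swapMonitor_sqDev_eq`** — `∫ (e^{−ΔS} − 1)² dP = e^{v} − 1`: the single-proposal variance of the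
  card's monitor `⟨e^{−ΔS}⟩` (`Theory2.gaussian_logweight_law` with `ℓ = −ΔS`);
* `le_var_of_model_acceptance_le` — model acceptance `erfc(√v/(2√2)) ≤ 1/5` ⇒ `v ≥ 6.48`;
  `exp_648_gt` — `643 < e^{6.48}`; **`swapMonitor_sqDev_gt`** — at model acceptance `≤ 20 %` the
  monitor's single-proposal variance EXCEEDS `642`.

Reading for CARD-su3-ptbc §3 / §14 (protocol note, no number of ours): per pair and per `n`
(effectively independent) proposals, the `⟨e^{−ΔS}⟩ = 1` tripwire resolves `|⟨e^{−ΔS}⟩ − 1| ≈ 3√((e^v−1)/n)`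
(`> 76/√n` at `≤ 20 %` acceptance: `n ≈ 6·10⁵` proposals for a `±0.1` test), while the sign rule
`acc = 2·frac(ΔS < 0) + frac(ΔS = 0)` resolves `3/√n` (`n ≈ 900` for `±0.1`) — and, unlike
`⟨e^{−ΔS}⟩ = 1` (implied by measure preservation of the swap alone), it uses the involutive structure
that detailed balance rests on.  Logging `#(ΔS < 0)` and `#(ΔS = 0)` per pair costs nothing.
Printed counterparts, NAMED ONLY: Creutz 1988 (`⟨e^{−ΔH}⟩ = 1`); Gupta–Irbäck–Karsch–Petersson 1990
(sign statistics of `ΔH`); Crooks 1999 (fluctuation relations).  Literature grade (cell rule):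
KNOWN MECHANISM, NEW TYPING (the swap instance; the certified variance comparison).  NOT CLAIMED: the
Gaussian model for PTBC (measured by the card's canaries, `≤ 1 pp`); autocorrelation of successive
proposals (the `n` above is an effective count); any number of a run.
-/

noncomputable section

namespace Summit.Ventures.LatticeQCDFlow.Exactness

open MeasureTheory Real ProbabilityTheory
open scoped NNReal
open Literature.Probability.MarkovChains
open Literature.ComputerArithmetic.BrentZimmermann2010.AsymptoticExpansions (erfc erfc_pos)
open Summit.Ventures.LatticeQCDFlow.Scaling (strictAnti_erfc erfc_09_gt)

variable {Ω : Type*} [MeasurableSpace Ω]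

/-! ## §1 The fluctuation relation and the sign rule for the swap proposal -/

section SignRule

omit [MeasurableSpace Ω] in
/-- `ΔS` is the energy violation `deltaH` of the pair energy under the swap proposal. [ours] -/
theorem deltaH_pairEnergy_swap (S₁ S₂ : Ω → ℝ) (z : Ω × Ω) :
    deltaH (pairEnergy S₁ S₂) Prod.swap z = swapDelta S₁ S₂ z := by
  rw [swapDelta_eq]
  rfl

variable (vol : Measure Ω) [SFinite vol] {S₁ S₂ : Ω → ℝ}

/-- **THE FLUCTUATION RELATION OF THE SWAP ENERGY.**  For every `g : ℝ → ℝ`: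
`∫ g(ΔS) e^{−E} d(vol⊗vol) = ∫ g(−ΔS) e^{−ΔS} e^{−E} d(vol⊗vol)` — the swap is a `vol ⊗ vol`-preserving
involution. [ours] -/
theorem swap_fluctuation_relation (g : ℝ → ℝ) :
    ∫ z, g (swapDelta S₁ S₂ z) * exp (-pairEnergy S₁ S₂ z) ∂(vol.prod vol)
      = ∫ z, g (-swapDelta S₁ S₂ z) * exp (-swapDelta S₁ S₂ z) * exp (-pairEnergy S₁ S₂ z)
          ∂(vol.prod vol) := by
  have h := integral_comp_deltaH_eq (μ := vol.prod vol) (H := pairEnergy S₁ S₂) measurable_swap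
    (fun z => Prod.swap_swap z) (measurePreserving_swap_prod_self vol) g
  simpa only [deltaH_pairEnergy_swap] using h

/-- **THE SIGN RULE: the stationary mean swap acceptance is `P(ΔS ≤ 0) + P(ΔS < 0)`** (weighted form):
`∫ min(1, e^{−ΔS}) e^{−E} = ∫ 𝟙[ΔS ≤ 0] e^{−E} + ∫ 𝟙[ΔS < 0] e^{−E}` for measurable actions with
`e^{−E}` integrable. [ours] -/
theorem swap_acceptance_sign_rule (h₁ : Measurable S₁) (h₂ : Measurable S₂)
    (hint : Integrable (fun z => exp (-pairEnergy S₁ S₂ z)) (vol.prod vol)) :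
    ∫ z, min 1 (exp (-swapDelta S₁ S₂ z)) * exp (-pairEnergy S₁ S₂ z) ∂(vol.prod vol)
      = (∫ z, (if swapDelta S₁ S₂ z ≤ 0 then (1 : ℝ) else 0) * exp (-pairEnergy S₁ S₂ z) ∂(vol.prod vol))
        + ∫ z, (if swapDelta S₁ S₂ z < 0 then (1 : ℝ) else 0) * exp (-pairEnergy S₁ S₂ z)
            ∂(vol.prod vol) := by
  have h := acceptance_integral_eq (μ := vol.prod vol) (measurable_pairEnergy h₁ h₂) measurable_swap
    (fun z => Prod.swap_swap z) (measurePreserving_swap_prod_self vol) hint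
  simpa only [deltaH_pairEnergy_swap] using h

/-- **The sign rule under the joint Boltzmann law** `π = e^{−E}(vol⊗vol)/Z` (`Z > 0`):
`∫ min(1, e^{−ΔS}) dπ = ∫ 𝟙[ΔS ≤ 0] dπ + ∫ 𝟙[ΔS < 0] dπ`. [ours] -/
theorem swap_acceptance_sign_rule_boltzmann (h₁ : Measurable S₁) (h₂ : Measurable S₂)
    (hint : Integrable (fun z => exp (-pairEnergy S₁ S₂ z)) (vol.prod vol))
    (hZ : 0 < HMC.partitionFn (vol.prod vol) (pairEnergy S₁ S₂)) :
    ∫ z, min 1 (exp (-swapDelta S₁ S₂ z)) ∂(HMC.boltzmann (vol.prod vol) (pairEnergy S₁ S₂))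
      = (∫ z, (if swapDelta S₁ S₂ z ≤ 0 then (1 : ℝ) else 0)
            ∂(HMC.boltzmann (vol.prod vol) (pairEnergy S₁ S₂)))
        + ∫ z, (if swapDelta S₁ S₂ z < 0 then (1 : ℝ) else 0)
            ∂(HMC.boltzmann (vol.prod vol) (pairEnergy S₁ S₂)) := by
  have hE := measurable_pairEnergy h₁ h₂
  rw [HMC.integral_boltzmann hE hZ, HMC.integral_boltzmann hE hZ, HMC.integral_boltzmann hE hZ, ← mul_add]
  congr 1
  have key := swap_acceptance_sign_rule vol h₁ h₂ hint
  simp_rw [mul_comm (exp (-pairEnergy S₁ S₂ _))]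
  exact key

/-- **Downhill swap energies are exponentially rare**: `∫ 𝟙[ΔS ≤ −c] e^{−E} ≤ e^{−c} ∫ 𝟙[ΔS ≥ c] e^{−E}`
(so `P(ΔS ≤ −c) ≤ e^{−c}`). [ours] -/
theorem swap_negative_tail_le (h₁ : Measurable S₁) (h₂ : Measurable S₂)
    (hint : Integrable (fun z => exp (-pairEnergy S₁ S₂ z)) (vol.prod vol)) (c : ℝ) :
    ∫ z, (if swapDelta S₁ S₂ z ≤ -c then (1 : ℝ) else 0) * exp (-pairEnergy S₁ S₂ z) ∂(vol.prod vol)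
      ≤ exp (-c) * ∫ z, (if c ≤ swapDelta S₁ S₂ z then (1 : ℝ) else 0) * exp (-pairEnergy S₁ S₂ z)
          ∂(vol.prod vol) := by
  have h := negative_tail_integral_le (μ := vol.prod vol) (measurable_pairEnergy h₁ h₂) measurable_swap
    (fun z => Prod.swap_swap z) (measurePreserving_swap_prod_self vol) hint c
  simpa only [deltaH_pairEnergy_swap] using h

/-- **The sign-rule statistic of one proposal with swap energy `d`**:
`T(d) = min(1, e^{−d}) − 𝟙[d ≤ 0] − 𝟙[d < 0]` (`= e^{−d}` uphill, `−1` downhill, `0` at `d = 0`). [ours] -/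
def signRuleStat (d : ℝ) : ℝ :=
  min 1 (exp (-d)) - (if d ≤ 0 then (1 : ℝ) else 0) - (if d < 0 then (1 : ℝ) else 0)

omit [MeasurableSpace Ω] in
/-- **`T² ≤ 1`**: the sign-rule statistic is bounded by one in absolute value, for every swap energy —
its single-proposal variance is at most `1` whatever the actions. [ours] -/
theorem signRuleStat_sq_le_one (d : ℝ) : signRuleStat d ^ 2 ≤ 1 := by
  unfold signRuleStat
  by_cases hd : d < 0
  · have h1 : (1 : ℝ) ≤ exp (-d) := by rw [← exp_zero]; exact exp_le_exp.mpr (by linarith)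
    rw [min_eq_left h1, if_pos hd.le, if_pos hd]; norm_num
  · by_cases hd0 : d = 0
    · subst hd0; simp
    · have hpos : 0 < d := lt_of_le_of_ne (not_lt.mp hd) (Ne.symm hd0)
      have h1 : exp (-d) ≤ 1 := by rw [← exp_zero]; exact exp_le_exp.mpr (by linarith)
      have h2 : 0 < exp (-d) := exp_pos _
      rw [min_eq_right h1, if_neg (not_le.mpr hpos), if_neg hd]
      nlinarith

omit [MeasurableSpace Ω] in
/-- `|T| ≤ 1`. [ours] -/
theorem abs_signRuleStat_le_one (d : ℝ) : |signRuleStat d| ≤ 1 :=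
  abs_le_one_iff_mul_self_le_one.mpr (by nlinarith [signRuleStat_sq_le_one d, sq_nonneg (signRuleStat d)])

/-- **The sign-rule statistic has equilibrium mean zero**: `∫ T(ΔS) e^{−E} d(vol⊗vol) = 0`. [ours] -/
theorem swap_signRuleStat_integral_eq_zero (h₁ : Measurable S₁) (h₂ : Measurable S₂)
    (hint : Integrable (fun z => exp (-pairEnergy S₁ S₂ z)) (vol.prod vol)) :
    ∫ z, signRuleStat (swapDelta S₁ S₂ z) * exp (-pairEnergy S₁ S₂ z) ∂(vol.prod vol) = 0 := by
  have hE := measurable_pairEnergy h₁ h₂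
  have hΔ : Measurable (swapDelta S₁ S₂) := by
    have h := measurable_deltaH hE (measurable_swap : Measurable (Prod.swap : Ω × Ω → Ω × Ω))
    have e : deltaH (pairEnergy S₁ S₂) Prod.swap = swapDelta S₁ S₂ := funext (deltaH_pairEnergy_swap S₁ S₂)
    rwa [e] at h
  have hwm : Measurable fun z : Ω × Ω => exp (-pairEnergy S₁ S₂ z) := measurable_exp.comp hE.neg
  have hw0 : ∀ z : Ω × Ω, 0 ≤ exp (-pairEnergy S₁ S₂ z) := fun z => (exp_pos _).le
  -- the three bounded pieces are integrable against the weight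
  have hmin_m : Measurable fun z : Ω × Ω => min 1 (exp (-swapDelta S₁ S₂ z)) :=
    measurable_const.min (measurable_exp.comp hΔ.neg)
  have hle_m : Measurable fun z : Ω × Ω => if swapDelta S₁ S₂ z ≤ 0 then (1 : ℝ) else 0 :=
    Measurable.ite (measurableSet_le hΔ measurable_const) measurable_const measurable_const
  have hlt_m : Measurable fun z : Ω × Ω => if swapDelta S₁ S₂ z < 0 then (1 : ℝ) else 0 :=
    Measurable.ite (measurableSet_lt hΔ measurable_const) measurable_const measurable_const
  have hI0 : Integrable (fun z => min 1 (exp (-swapDelta S₁ S₂ z)) * exp (-pairEnergy S₁ S₂ z))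
      (vol.prod vol) := by
    refine integrable_bdd_mul_weight hmin_m (C := 1) (fun z => ?_) hwm hw0 hint
    rw [abs_of_pos (lt_min one_pos (exp_pos _))]
    exact min_le_left _ _
  have hI1 : Integrable (fun z => (if swapDelta S₁ S₂ z ≤ 0 then (1 : ℝ) else 0) * exp (-pairEnergy S₁ S₂ z))
      (vol.prod vol) := by
    refine integrable_bdd_mul_weight hle_m (C := 1) (fun z => ?_) hwm hw0 hint
    split_ifs <;> simp
  have hI2 : Integrable (fun z => (if swapDelta S₁ S₂ z < 0 then (1 : ℝ) else 0) * exp (-pairEnergy S₁ S₂ z))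
      (vol.prod vol) := by
    refine integrable_bdd_mul_weight hlt_m (C := 1) (fun z => ?_) hwm hw0 hint
    split_ifs <;> simp
  have key := swap_acceptance_sign_rule vol h₁ h₂ hint
  have hsplit : ∀ z : Ω × Ω, signRuleStat (swapDelta S₁ S₂ z) * exp (-pairEnergy S₁ S₂ z)
      = min 1 (exp (-swapDelta S₁ S₂ z)) * exp (-pairEnergy S₁ S₂ z)
        - (if swapDelta S₁ S₂ z ≤ 0 then (1 : ℝ) else 0) * exp (-pairEnergy S₁ S₂ z)
        - (if swapDelta S₁ S₂ z < 0 then (1 : ℝ) else 0) * exp (-pairEnergy S₁ S₂ z) := by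
    intro z; unfold signRuleStat; ring
  have hI01 : Integrable (fun z => min 1 (exp (-swapDelta S₁ S₂ z)) * exp (-pairEnergy S₁ S₂ z)
      - (if swapDelta S₁ S₂ z ≤ 0 then (1 : ℝ) else 0) * exp (-pairEnergy S₁ S₂ z)) (vol.prod vol) :=
    hI0.sub hI1
  simp_rw [hsplit]
  rw [integral_sub hI01 hI2, integral_sub hI0 hI1, key]
  ring

/-- **The sign-rule statistic has mean zero under the joint Boltzmann law** `π = e^{−E}(vol⊗vol)/Z`
(`Z > 0`): `∫ T(ΔS) dπ = 0`. [ours] -/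
theorem swap_signRuleStat_integral_boltzmann_eq_zero (h₁ : Measurable S₁) (h₂ : Measurable S₂)
    (hint : Integrable (fun z => exp (-pairEnergy S₁ S₂ z)) (vol.prod vol))
    (hZ : 0 < HMC.partitionFn (vol.prod vol) (pairEnergy S₁ S₂)) :
    ∫ z, signRuleStat (swapDelta S₁ S₂ z) ∂(HMC.boltzmann (vol.prod vol) (pairEnergy S₁ S₂)) = 0 := by
  rw [HMC.integral_boltzmann (measurable_pairEnergy h₁ h₂) hZ]
  simp_rw [mul_comm (exp (-pairEnergy S₁ S₂ _))]
  rw [swap_signRuleStat_integral_eq_zero vol h₁ h₂ hint, mul_zero]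

end SignRule

/-! ## §2 The Gaussian swap model: the `⟨e^{−ΔS}⟩` monitor has single-proposal variance `e^{v} − 1` -/

section Gaussian

variable {Ω' : Type*} [MeasurableSpace Ω'] {P : Measure Ω'} [IsProbabilityMeasure P] {D : Ω' → ℝ}
  {m : ℝ} {v : ℝ≥0}

/-- **`∫ (e^{−ΔS} − 1)² dP = e^{v} − 1`** when `ΔS ∼ N(m, v)` under `P` and `⟨e^{−ΔS}⟩ = 1` (which forces
`m = v/2`): the single-proposal variance of the `⟨e^{−ΔS}⟩` monitor in the Gaussian swap model. [ours] -/
theorem swapMonitor_sqDev_eq (hDm : Measurable D) (hD : P.map D = gaussianReal m v)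
    (hmon : ∫ ω, exp (-D ω) ∂P = 1) :
    ∫ ω, (exp (-D ω) - 1) ^ 2 ∂P = exp (v : ℝ) - 1 := by
  -- the log-weight `ℓ = −ΔS` is `N(−m, v)` with `mgf ℓ 1 = 1`
  set ℓ : Ω' → ℝ := fun ω => -D ω with hℓ
  have hℓlaw : P.map ℓ = gaussianReal (-m) v := by
    have e : ℓ = (fun x : ℝ => -x) ∘ D := rfl
    rw [e, ← Measure.map_map measurable_neg hDm, hD, gaussianReal_map_neg]
  have hmgf1 : mgf ℓ P 1 = 1 := by
    rw [mgf]
    simpa only [hℓ, one_mul] using hmon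
  have hmgf2 : mgf ℓ P 2 = exp (v : ℝ) := (Theory2.gaussian_logweight_law hℓlaw hmgf1).2
  -- integrability of `e^{ℓ}` and `e^{2ℓ}` from the non-vanishing of the mgf values
  have hint1 : Integrable (fun ω => exp (1 * ℓ ω)) P := by
    by_contra h
    have h0 := integral_undef h
    rw [mgf] at hmgf1
    rw [h0] at hmgf1
    exact zero_ne_one hmgf1
  have hint2 : Integrable (fun ω => exp (2 * ℓ ω)) P := by
    by_contra h
    have h0 := integral_undef h
    rw [mgf] at hmgf2
    rw [h0] at hmgf2
    exact (exp_pos _).ne' hmgf2.symm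
  have hsq : ∀ ω, (exp (-D ω) - 1) ^ 2 = (exp (2 * ℓ ω) - 2 * exp (1 * ℓ ω)) + 1 := by
    intro ω
    have e2 : exp (2 * ℓ ω) = exp (ℓ ω) ^ 2 := by rw [← Real.exp_nat_mul]; norm_num
    rw [e2, one_mul, hℓ]
    ring
  have hint1' : Integrable (fun ω => 2 * exp (1 * ℓ ω)) P := hint1.const_mul 2
  have hint12 : Integrable (fun ω => exp (2 * ℓ ω) - 2 * exp (1 * ℓ ω)) P := hint2.sub hint1'
  simp_rw [hsq]
  rw [integral_add hint12 (integrable_const 1), integral_sub hint2 hint1', integral_const_mul]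
  rw [mgf] at hmgf1 hmgf2
  rw [hmgf2, hmgf1]
  simp only [integral_const, probReal_univ, smul_eq_mul, mul_one]
  ring

omit [IsProbabilityMeasure P] in
/-- **Model acceptance `≤ 20 %` forces `Var ΔS ≥ 6.48`**: `erfc(√v/(2√2)) ≤ 1/5 ⇒ 6.48 ≤ v`
(`erfc` strictly decreasing and `erfc 0.9 > 1/5`, `SwapSpacingBrackets`). [ours] -/
theorem le_var_of_model_acceptance_le {v : ℝ} (hv : 0 ≤ v)
    (hacc : erfc (Real.sqrt v / (2 * Real.sqrt 2)) ≤ 1 / 5) : 648 / 100 ≤ v := by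
  have h1 : erfc (Real.sqrt v / (2 * Real.sqrt 2)) < erfc (9 / 10) := lt_of_le_of_lt hacc erfc_09_gt
  have h2 : 9 / 10 < Real.sqrt v / (2 * Real.sqrt 2) := by
    by_contra hle
    exact absurd h1 (not_lt.mpr (strictAnti_erfc.antitone (not_lt.mp hle)))
  have h3 : 9 / 10 * (2 * Real.sqrt 2) < Real.sqrt v := (lt_div_iff₀ (by positivity)).mp h2
  have hs2 : Real.sqrt 2 ^ 2 = 2 := Real.sq_sqrt (by norm_num)
  have hsv : Real.sqrt v ^ 2 = v := Real.sq_sqrt hv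
  have h4 : 0 ≤ 9 / 10 * (2 * Real.sqrt 2) := by positivity
  nlinarith [h3, hs2, hsv, h4, Real.sqrt_nonneg v]

omit [MeasurableSpace Ω'] [IsProbabilityMeasure P] in
/-- **`643 < e^{6.48}`** (`e > 2.7182818283`, `e^{0.48} ≥ 1 + 0.48 + 0.48²/2`). [ours] -/
theorem exp_648_gt : (643 : ℝ) < exp (648 / 100) := by
  have he := Real.exp_one_gt_d9
  have h6 : exp 6 = exp 1 ^ 6 := by rw [← Real.exp_nat_mul]; norm_num
  have h48 : (1 : ℝ) + 48 / 100 + (48 / 100) ^ 2 / 2 ≤ exp (48 / 100) :=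
    Real.quadratic_le_exp_of_nonneg (by norm_num)
  have hsplit : exp (648 / 100 : ℝ) = exp 6 * exp (48 / 100) := by
    rw [← Real.exp_add]; norm_num
  have hpow : (2.7182818283 : ℝ) ^ 6 < exp 1 ^ 6 := pow_lt_pow_left₀ he (by norm_num) (by norm_num)
  rw [hsplit, h6]
  calc (643 : ℝ) < (2.7182818283 : ℝ) ^ 6 * (1 + 48 / 100 + (48 / 100) ^ 2 / 2) := by norm_num
    _ ≤ exp 1 ^ 6 * exp (48 / 100) := mul_le_mul hpow.le h48 (by norm_num) (by positivity)

/-- **AT MODEL ACCEPTANCE `≤ 20 %` THE `⟨e^{−ΔS}⟩` MONITOR HAS SINGLE-PROPOSAL VARIANCE `> 642`**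
(`ΔS ∼ N(m, v)`, `⟨e^{−ΔS}⟩ = 1`, model acceptance `erfc(√v/(2√2)) ≤ 1/5`), against `≤ 1` for the sign-rule
statistic (`signRuleStat_sq_le_one`). [ours] -/
theorem swapMonitor_sqDev_gt (hDm : Measurable D) (hD : P.map D = gaussianReal m v)
    (hmon : ∫ ω, exp (-D ω) ∂P = 1)
    (hacc : erfc (Real.sqrt (v : ℝ) / (2 * Real.sqrt 2)) ≤ 1 / 5) :
    (642 : ℝ) < ∫ ω, (exp (-D ω) - 1) ^ 2 ∂P := by
  rw [swapMonitor_sqDev_eq hDm hD hmon]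
  have hv := le_var_of_model_acceptance_le v.coe_nonneg hacc
  have h1 : exp (648 / 100 : ℝ) ≤ exp (v : ℝ) := exp_le_exp.mpr hv
  linarith [exp_648_gt]

end Gaussian

end Summit.Ventures.LatticeQCDFlow.Exactness

end
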